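import Literature.MathematicalPhysics.QuantumFieldTheory.Balaban1983to89.B13WalksOfB9FactorsReading
import Literature.MathematicalPhysics.QuantumFieldTheory.Balaban1983to89.B13AccretiveOfRealCoercive

/-!
# `Balaban1983to89.B13WalksOfB9FactorsReadingCoercive` — T. Bałaban, *Propagators for lattice gauge theories in a background field*, Commun.
Math. Phys. **99** (1985) 389–434 [Balaban1985BackgroundPropagators] («[13]» of [Balaban1988RG2Cluster]), (3.26)–(3.27) p. 395, Thm 3.4 p. 400 + Sect. B
(3.62)–(3.64) p. 402 («small perturbations of the operators depending on U only»), Thm 3.10 (3.107)–(3.108) p. 416, Thm 3.11 p. 416, p. 428 («lower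
bound γ₀ > 0 independent of k and U … (3.35), (3.36) with Mα₀ sufficiently small»); *Renormalization group approach to lattice gauge field theories. II*,
Commun. Math. Phys. **116** (1988) 1–22 [Balaban1988RG2Cluster] p. 13, p. 15 («the general case is handled by a perturbative argument»): THE N06 → N10
INVERSE ROAD ALONG A LOCATED SITE READING WITH THE COMPLEX ACCRETIVITY MARGIN DERIVED — module 55A (`B13WalksOfB9FactorsReading`) §4's [B9] Thm 3.4-shaped
road `rawEntryLetters_inv_of_conv3107_realSlice_reading(_radii)` with its displayed pair `hmA : 0 < m_A`, `hacc : ∀ u ∈ ball 0 R_an, m_A·Σ|w_i|² ≤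
Re Σ w̄_i(A(u)w)_i` (an accretivity margin of the COMPLEXIFIED `Δ_a` on the whole complex ball — nobody's theorem, not a printed statement) REPLACED by
print's REAL lower bound of `Δ_a` over the class (3.35) (`hcoer`, N06's currency) + a majorant of the complexified operator on the complex ball with
bounded absolute row ∕ column sums (`hMx hrow hcol hS` — the [II] p. 15 ∕ [I] p. 263 in-edge) + a thin radius `R₁` (`2S·R₁∕R_an ≤ γ∕2`), the margin
`γ∕2` on `‖u‖ < R₁` being module 56A's THEOREM `B13AccretiveOfRealCoercive.accretive_ball_of_realCoercive` (Schwarz lemma); and the same AT THE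
IDENTITY READING OF THE TORUS FRAME `torusGeom Nf η L M` (module 33 ∕ 39's setting: `loc = id`, `sℓ = 1`, `ℓ_max = η`) — which also certifies
that 55A's located-reading hypotheses `hloc ∕ hlen` are inhabited (census v12 (t-A2-55)).

statement-level bookkeeping over the landed modules 55A ∕ 56A with citation tags; kernel-checked; nothing here is a claim about the Yang–Mills mass
gap; nothing of Bałaban's operators is constructed or asserted; no node is discharged; count-neutral.

WHY THIS FILE (cell `pub-ymgap`, HUMAN RULING D-0062, Track A node N10 = [B13]; seat `pub-ymgap-dag-n10-c` g12, module 57; census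
`N10-RESIDUAL-CENSUS-v13.md`).  Module 56B did this AT def-Y's members (`Thm/…N10EntryLettersOfN06RecordFaceB`); this is the GEOMETRY-GENERIC
Literature twin for every [B9] face `g : B9.Geometry` N06 may certify on, and its torus specialisation.
* §1 ★★ `rawEntryLetters_inv_of_conv3107_realCoercive_reading` (+ `_radii`) — 55A §4 at radius `R₁` with `m_A := γ∕2` derived.
* §2 the identity reading of the torus frame: `reading_torusGeom_dist` (`1·d₁(a,b) ≤ dist a b`), `reading_torusGeom_len` (`len ≤ η`),
  `rawEntryLetters_G_of_conv3107_torus` (55A §2 at the identity reading of module 33's torus frame: locations `blk`, rate `δ`, constant `Cη²`),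
  ★ `rawEntryLetters_inv_of_conv3107_realCoercive_torus` (module 39's frame: locations `blk`, rate `(1−λ(r))·δ`, constant `(Cη²)^{1−λ}(max (Cη²) (4∕γ))^{λ}`).
A2 ∕ A6.  N06's `Conv3107 ∕ Identities310` are N06's displayed content; the analytic block (holomorphy + majorant + real coercivity + thin radius +
real-slice decay) is jointly inhabited with genuine `u`-dependence by `B13AccretiveOfRealCoercive.rawEntryLetters_inv_of_realCoercive_toy`; §2
inhabits 55A's reading hypotheses by the identity reading.
HONEST FRAMING: hypotheses about N06's objects (GAPS G-B9-05∕06a∕07) and the [II] p. 15 in-edge; NOTHING of Bałaban's constructed or asserted; neither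
N06 nor N10 discharged; count-neutral; 0 `def`, 0 `sorry`; standard axioms; one finite 𝕋⁴ programme at fixed ε — nothing continuum ∕ OS ∕ mass gap ∕ Clay.
-/

noncomputable section

namespace Literature.MathematicalPhysics.QuantumFieldTheory.Balaban1983to89.B13WalksOfB9FactorsReadingCoercive

open Metric Set Finset
open scoped Matrix
open Literature.MathematicalPhysics.QuantumFieldTheory.Balaban1983to89
open Literature.MathematicalPhysics.QuantumFieldTheory.Balaban1983to89.B9Thm37GlueTorus (tdist1 tdist1_nonneg torusGeom len_torusGeom)
open Literature.MathematicalPhysics.QuantumFieldTheory.Balaban1983to89.B5TorusCover (UT)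
open Literature.MathematicalPhysics.QuantumFieldTheory.Balaban1983to89.B9Thm310Whole (Ops310 Identities310 Conv3107)
open Literature.MathematicalPhysics.QuantumFieldTheory.Balaban1983to89.B13EntrywiseWalks (RawEntryLetters)
open Literature.MathematicalPhysics.QuantumFieldTheory.Balaban1983to89.B13RealSliceEntryLetters (RealStructure lam lam_radii_le)
open Literature.MathematicalPhysics.QuantumFieldTheory.Balaban1983to89.B13AccretiveOfRealCoercive (accretive_ball_of_realCoercive)
open Literature.MathematicalPhysics.QuantumFieldTheory.Balaban1983to89.B13WalksOfB9FactorsReading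
  (rawEntryLetters_inv_of_conv3107_realSlice_reading)

variable {X : Type} [Fintype X] [DecidableEq X]
variable {ν : ℕ} {Nf : Fin ν → ℕ} [∀ i, NeZero (Nf i)]
variable {E : Type*} [NormedAddCommGroup E] [NormedSpace ℂ E]

/-! ## §1. The inverse road along a located reading, the complex accretivity margin derived from the real lower bound -/

section Ops

variable {g : B9.Geometry} [Fintype g.Site] [DecidableEq g.Site]
variable {Bg : B9.Backgrounds} {Y ι A : Type} [Fintype ι] [Fintype A]
variable (𝔬 : Ops310 g Bg X Y ι A) {Rr : ℝ} {H : Prop}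

omit [DecidableEq g.Site] in
/-- ★★ **THE [B9] THM 3.4-SHAPED INVERSE ROAD ALONG A READING, MARGIN DERIVED** (= 55A §4 `rawEntryLetters_inv_of_conv3107_realSlice_reading` with
`hmA ∕ hacc` DISCHARGED).  Inputs: a real structure `ℛ` on `E`; a REAL FAMILY of backgrounds `U_v` with N06's conclusion `Conv3107 𝔬 R H C δ U_v` and
structure `Identities310 𝔬 R H U_v` at every real `v` of the ball `‖v‖ < R_an`; the located reading (`loc`, `sℓ ≥ 0` with `sℓ·d₁(loc a, loc b) ≤ dist a b`,
`0 ≤ len ≤ ℓ_max`); the complexified operator `A : E → Matrix X X ℂ` which at every real `v` IS `M(𝔬.Δa U_v)` (`hslice`), entrywise holomorphic on the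
ball (`hA`) with a majorant `Mx` of absolute row ∕ column sums `≤ S` (`hMx hrow hcol hS` — [II] p. 15's complex-chart datum); print's REAL lower bound
`hcoer : ∀ v ∈ ℛ.Ereal, ‖v‖ < R_an → Coercive (M(𝔬.Δa U_v)) γ`, `γ > 0` ([B9] p. 395 ∕ Thm 3.11 ∕ p. 428); the thin radius `0 < R₁ ≤ R_an` with
`2S·R₁∕R_an ≤ γ∕2`; `0 < r < 1`.  Conclusion: `RawEntryLetters (u ↦ A(u)⁻¹)` on `‖u‖ < (r∕(1+r))R₁`, locations `loc ∘ blk`, rate `(1 − λ(r))·(δ·sℓ)`,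
constant `(Cℓ_max²)^{1−λ}(max (Cℓ_max²) (4∕γ))^{λ}`.
[cite: Balaban1985BackgroundPropagators, (3.26)–(3.27) p.395, Thm 3.4 p.400, (3.62)–(3.64) p.402, Thm 3.10 (3.107)–(3.108) p.416, Thm 3.11 p.416, p.428;
Balaban1988RG2Cluster, p.13, p.15; Balaban1987RG1, (1.13)–(1.14) p.262; Ransford1995, Thm. 4.3.7] -/
theorem rawEntryLetters_inv_of_conv3107_realCoercive_reading (ℛ : RealStructure E) {Aop : E → Matrix X X ℂ} (Uv : E → Bg.Cfg)
    {Ran R₁ S γ r C δ ℓmax sℓ : ℝ} {Mx : X → X → ℝ}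
    (hc : ∀ v ∈ ℛ.Ereal, ‖v‖ < Ran → Conv3107 𝔬 Rr H C δ (Uv v))
    (hI : ∀ v ∈ ℛ.Ereal, ‖v‖ < Ran → Identities310 𝔬 Rr H (Uv v)) (hC : 0 ≤ C) (hδ : 0 ≤ δ)
    (hlen0 : ∀ a : g.Site, 0 ≤ g.len a) (hlen : ∀ a : g.Site, g.len a ≤ ℓmax)
    (loc : g.Site → UT Nf) (hsℓ : 0 ≤ sℓ) (hloc : ∀ a b, sℓ * tdist1 Nf (loc a) (loc b) ≤ g.dist a b)
    (hslice : ∀ v ∈ ℛ.Ereal, ‖v‖ < Ran → Aop v = (LinearMap.toMatrix' (𝔬.Δa (Uv v))).map (algebraMap ℝ ℂ))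
    (hA : ∀ i j, DifferentiableOn ℂ (fun u => Aop u i j) (ball (0 : E) Ran))
    (hMx : ∀ u ∈ ball (0 : E) Ran, ∀ i j, ‖Aop u i j‖ ≤ Mx i j)
    (hrow : ∀ i, ∑ j, Mx i j ≤ S) (hcol : ∀ j, ∑ i, Mx i j ≤ S) (hS : 0 ≤ S)
    (hγ : 0 < γ) (hcoer : ∀ v ∈ ℛ.Ereal, ‖v‖ < Ran → QGQInverse.Coercive (LinearMap.toMatrix' (𝔬.Δa (Uv v))) γ)
    (hR₁ : 0 < R₁) (hR₁R : R₁ ≤ Ran) (hsmall : 2 * S * R₁ / Ran ≤ γ / 2) (hr0 : 0 < r) (hr1 : r < 1) :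
    RawEntryLetters (fun u => (Aop u)⁻¹) (loc ∘ 𝔬.blk) (r / (1 + r) * R₁) ((1 - lam r) * (δ * sℓ))
      ((C * ℓmax ^ 2) ^ (1 - lam r) * (max (C * ℓmax ^ 2) (4 / γ)) ^ lam r) := by
  have hreal : ∀ v ∈ ℛ.Ereal, ‖v‖ < Ran →
      ∃ T₀ : Matrix X X ℝ, Aop v = T₀.map (algebraMap ℝ ℂ) ∧ QGQInverse.Coercive T₀ γ :=
    fun v hv hvR => ⟨_, hslice v hv hvR, hcoer v hv hvR⟩
  have hacc : ∀ u ∈ ball (0 : E) R₁, ∀ w : X → ℂ,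
      γ / 2 * ∑ i, ‖w i‖ ^ 2 ≤ (∑ i, star (w i) * (Aop u *ᵥ w) i).re := by
    intro u hu w
    have h := accretive_ball_of_realCoercive ℛ hA hMx hrow hcol hS hreal hR₁ hR₁R u hu w
    have hsum : 0 ≤ ∑ i, ‖w i‖ ^ 2 := sum_nonneg fun i _ => by positivity
    have hle : γ / 2 ≤ γ - 2 * S * R₁ / Ran := by linarith
    exact (mul_le_mul_of_nonneg_right hle hsum).trans h
  have h := rawEntryLetters_inv_of_conv3107_realSlice_reading 𝔬 ℛ Uv (Ran := R₁)
    (fun v hv hvR => hc v hv (hvR.trans_le hR₁R)) (fun v hv hvR => hI v hv (hvR.trans_le hR₁R)) hC hδ hlen0 hlen loc hsℓ hloc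
    (fun v hv hvR => hslice v hv (hvR.trans_le hR₁R)) (fun i j => (hA i j).mono (ball_subset_ball hR₁R)) (half_pos hγ) hacc hr0 hr1
  have e : (2 : ℝ) / (γ / 2) = 4 / γ := by
    rw [div_div_eq_mul_div]; ring
  rw [e] at h
  exact h

omit [DecidableEq g.Site] in
/-- ★ **RADII EDITION**: the consumer's radius `R₀ > 0` literally, the thin radius `R₁ > 2R₀`, the analyticity radius `R_an ≥ R₁`; rate loss
`λ(R₀∕(R₁ − R₀)) ≤ (4∕π)R₀∕(R₁ − R₀)`.
[cite: Balaban1985BackgroundPropagators, Thm 3.4 p.400, Thm 3.10 (3.108) p.416, Thm 3.11 p.416, p.428; Balaban1988RG2Cluster, p.15; Balaban1987RG1, (1.13)–(1.14) p.262; Ransford1995, Thm. 4.3.7] -/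
theorem rawEntryLetters_inv_of_conv3107_realCoercive_reading_radii (ℛ : RealStructure E) {Aop : E → Matrix X X ℂ}
    (Uv : E → Bg.Cfg) {Ran R₁ R₀ S γ C δ ℓmax sℓ : ℝ} {Mx : X → X → ℝ}
    (hc : ∀ v ∈ ℛ.Ereal, ‖v‖ < Ran → Conv3107 𝔬 Rr H C δ (Uv v))
    (hI : ∀ v ∈ ℛ.Ereal, ‖v‖ < Ran → Identities310 𝔬 Rr H (Uv v)) (hC : 0 ≤ C) (hδ : 0 ≤ δ)
    (hlen0 : ∀ a : g.Site, 0 ≤ g.len a) (hlen : ∀ a : g.Site, g.len a ≤ ℓmax)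
    (loc : g.Site → UT Nf) (hsℓ : 0 ≤ sℓ) (hloc : ∀ a b, sℓ * tdist1 Nf (loc a) (loc b) ≤ g.dist a b)
    (hslice : ∀ v ∈ ℛ.Ereal, ‖v‖ < Ran → Aop v = (LinearMap.toMatrix' (𝔬.Δa (Uv v))).map (algebraMap ℝ ℂ))
    (hA : ∀ i j, DifferentiableOn ℂ (fun u => Aop u i j) (ball (0 : E) Ran))
    (hMx : ∀ u ∈ ball (0 : E) Ran, ∀ i j, ‖Aop u i j‖ ≤ Mx i j)
    (hrow : ∀ i, ∑ j, Mx i j ≤ S) (hcol : ∀ j, ∑ i, Mx i j ≤ S) (hS : 0 ≤ S)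
    (hγ : 0 < γ) (hcoer : ∀ v ∈ ℛ.Ereal, ‖v‖ < Ran → QGQInverse.Coercive (LinearMap.toMatrix' (𝔬.Δa (Uv v))) γ)
    (hR₀ : 0 < R₀) (h2 : 2 * R₀ < R₁) (hR₁R : R₁ ≤ Ran) (hsmall : 2 * S * R₁ / Ran ≤ γ / 2) :
    RawEntryLetters (fun u => (Aop u)⁻¹) (loc ∘ 𝔬.blk) R₀ ((1 - lam (R₀ / (R₁ - R₀))) * (δ * sℓ))
      ((C * ℓmax ^ 2) ^ (1 - lam (R₀ / (R₁ - R₀))) *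
        (max (C * ℓmax ^ 2) (4 / γ)) ^ lam (R₀ / (R₁ - R₀))) ∧
      lam (R₀ / (R₁ - R₀)) ≤ 4 / Real.pi * (R₀ / (R₁ - R₀)) := by
  have hd : 0 < R₁ - R₀ := by linarith
  have hR₁ : 0 < R₁ := by linarith
  have hr0 : 0 < R₀ / (R₁ - R₀) := div_pos hR₀ hd
  have hr1 : R₀ / (R₁ - R₀) < 1 := (div_lt_one hd).2 (by linarith)
  have h := rawEntryLetters_inv_of_conv3107_realCoercive_reading 𝔬 ℛ Uv hc hI hC hδ hlen0 hlen loc hsℓ hloc hslice hA hMx hrow hcol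
    hS hγ hcoer hR₁ hR₁R hsmall hr0 hr1
  have e : R₀ / (R₁ - R₀) / (1 + R₀ / (R₁ - R₀)) * R₁ = R₀ := by
    field_simp
    ring
  rw [e] at h
  exact ⟨h, lam_radii_le hR₀.le h2⟩

end Ops

/-! ## §2. At the identity reading of the torus frame `torusGeom Nf η L M` (module 33 ∕ 39's setting; census (t-A2-55)) -/

section Torus

variable {η L M : ℝ}
variable {Bg : B9.Backgrounds} {Y ι A : Type} [Fintype ι] [Fintype A]
variable (𝔬 : Ops310 (torusGeom Nf η L M) Bg X Y ι A) {Rr : ℝ} {H : Prop}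

omit [Fintype X] [DecidableEq X] [NormedAddCommGroup E] [NormedSpace ℂ E] in
/-- The identity reading of the torus frame contracts nothing: `1·d₁(a, b) ≤ dist a b` (the frame's distance IS `d₁`).
[cite: Balaban1984PropagatorsII, (2.4) p.224; Balaban1985BackgroundPropagators, (3.41) p.397] -/
theorem reading_torusGeom_dist (a b : (torusGeom Nf η L M).Site) :
    1 * tdist1 Nf (id a) (id b) ≤ (torusGeom Nf η L M).dist a b := by
  rw [one_mul]; exact le_rfl

omit [Fintype X] [DecidableEq X] [NormedAddCommGroup E] [NormedSpace ℂ E] in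
/-- Every length of the torus frame is `η` (so `ℓ_max = η`). [cite: Balaban1985BackgroundPropagators, (3.41) p.397] -/
theorem reading_torusGeom_len (a : (torusGeom Nf η L M).Site) : (torusGeom Nf η L M).len a ≤ η :=
  (len_torusGeom (N := Nf) η L M a).le

omit [Fintype ι] [Fintype A] in
/-- **55A §2 AT THE IDENTITY READING OF MODULE 33's TORUS FRAME**: N06's conclusion `Conv3107 𝔬 R H C δ U` on the torus frame (`η ≥ 0`) gives N10's
entry letters of `M(G(U))` with locations `blk`, rate `δ`, constant `C·η²` on every ball — 55A `rawEntryLetters_G_of_conv3107_reading` at `loc = id`,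
`sℓ = 1`, `ℓ_max = η` (the located-reading hypotheses inhabited; census (t-A2-55); module 33 itself reads the SCHEMAS on this frame, 55A §3's road).
[cite: Balaban1985BackgroundPropagators, (3.41) p.397, Thm 3.10 (3.107)–(3.108) p.416; Balaban1988RG2Cluster, p.13, (2.16) p.16] -/
theorem rawEntryLetters_G_of_conv3107_torus (hη : 0 ≤ η) {C δ : ℝ} {U : Bg.Cfg} (hc : Conv3107 𝔬 Rr H C δ U) (hC : 0 ≤ C)
    (hδ : 0 ≤ δ) (Rball : ℝ) :
    RawEntryLetters (Nf := Nf) (fun (_ : E) => (LinearMap.toMatrix' (𝔬.G U)).map (algebraMap ℝ ℂ)) 𝔬.blk Rball δ (C * η ^ 2) := by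
  have h := B13WalksOfB9FactorsReading.rawEntryLetters_G_of_conv3107_reading (E := E) 𝔬 hc hC hδ
    (fun a => (len_torusGeom (N := Nf) η L M a).symm ▸ hη) reading_torusGeom_len id reading_torusGeom_dist Rball
  rw [mul_one] at h
  exact h

/-- ★ **THE INVERSE ROAD ON THE TORUS FRAME, MARGIN DERIVED** (module 39 §3's setting `torusGeom Nf η L M`, identity reading; `η ≥ 0`): from N06's
`Conv3107 ∕ Identities310` at every real background of the ball, the complexified `Δ_a` (`hslice hA` + majorant `hMx hrow hcol hS`), print's real lower
bound `hcoer`, the thin radius: `RawEntryLetters (u ↦ A(u)⁻¹)` with locations `blk`, rate `(1−λ(r))·δ`, constant `(Cη²)^{1−λ}(max (Cη²) (4∕γ))^{λ}`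
on `‖u‖ < (r∕(1+r))R₁` — §1 at `loc = id`, `sℓ = 1`, `ℓ_max = η`; in particular 55A's reading hypotheses are inhabited.
[cite: Balaban1985BackgroundPropagators, (3.26)–(3.27) p.395, (3.41) p.397, Thm 3.4 p.400, Thm 3.10 (3.107)–(3.108) p.416, Thm 3.11 p.416, p.428;
Balaban1988RG2Cluster, p.13, p.15; Ransford1995, Thm. 4.3.7] -/
theorem rawEntryLetters_inv_of_conv3107_realCoercive_torus (hη : 0 ≤ η) (ℛ : RealStructure E) {Aop : E → Matrix X X ℂ}
    (Uv : E → Bg.Cfg) {Ran R₁ S γ r C δ : ℝ} {Mx : X → X → ℝ}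
    (hc : ∀ v ∈ ℛ.Ereal, ‖v‖ < Ran → Conv3107 𝔬 Rr H C δ (Uv v))
    (hI : ∀ v ∈ ℛ.Ereal, ‖v‖ < Ran → Identities310 𝔬 Rr H (Uv v)) (hC : 0 ≤ C) (hδ : 0 ≤ δ)
    (hslice : ∀ v ∈ ℛ.Ereal, ‖v‖ < Ran → Aop v = (LinearMap.toMatrix' (𝔬.Δa (Uv v))).map (algebraMap ℝ ℂ))
    (hA : ∀ i j, DifferentiableOn ℂ (fun u => Aop u i j) (ball (0 : E) Ran))
    (hMx : ∀ u ∈ ball (0 : E) Ran, ∀ i j, ‖Aop u i j‖ ≤ Mx i j)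
    (hrow : ∀ i, ∑ j, Mx i j ≤ S) (hcol : ∀ j, ∑ i, Mx i j ≤ S) (hS : 0 ≤ S)
    (hγ : 0 < γ) (hcoer : ∀ v ∈ ℛ.Ereal, ‖v‖ < Ran → QGQInverse.Coercive (LinearMap.toMatrix' (𝔬.Δa (Uv v))) γ)
    (hR₁ : 0 < R₁) (hR₁R : R₁ ≤ Ran) (hsmall : 2 * S * R₁ / Ran ≤ γ / 2) (hr0 : 0 < r) (hr1 : r < 1) :
    RawEntryLetters (fun u => (Aop u)⁻¹) 𝔬.blk (r / (1 + r) * R₁) ((1 - lam r) * δ)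
      ((C * η ^ 2) ^ (1 - lam r) * (max (C * η ^ 2) (4 / γ)) ^ lam r) := by
  have h := rawEntryLetters_inv_of_conv3107_realCoercive_reading 𝔬 ℛ Uv hc hI hC hδ
    (fun a => (len_torusGeom (N := Nf) η L M a).symm ▸ hη) reading_torusGeom_len id zero_le_one reading_torusGeom_dist hslice hA hMx
    hrow hcol hS hγ hcoer hR₁ hR₁R hsmall hr0 hr1
  rw [mul_one] at h
  exact h

end Torus

end Literature.MathematicalPhysics.QuantumFieldTheory.Balaban1983to89.B13WalksOfB9FactorsReadingCoercive

end
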